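import Literature.Probability.Process.StableLikeJumpChainEntropy
import HarnessLib

/-!
# Entropy of the law of a stable-like chain: bounds and two-step dissipation

Support file for the proof of Bass–Levin 2002, Theorem 1.1
(`Literature.Probability.Process.bassLevin_thm_1_1`). For a reversible stable-like Markov kernel
on `ℤ^d` (interface of `StableLikeJumpChainDiag`) and a starting point `x`, write
`f_n(z) = Q n x z / μ z` for the density of the time-`n` law with respect to `μ` and
`H(n) = -∑_z μ_z f_n(z) log f_n(z)` for its entropy. We prove:

* `entropy_summable` : `z ↦ μ_z f_n(z) log f_n(z)` is absolutely summable (finite `β`-moment);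
* `entropy_lower` : `H(n) ≥ (d/α) log n − log (C_D/m)` from the on-diagonal bound;
* `entropy_upper` : `H(n) ≤ A + (d/β) log M_β(n)` (Gibbs' inequality against `e^{-λ(1+‖z−x‖)^β}`);
* `entropy_fubini` : `∑_z μ_z φ(z) = ∑_y μ_y ∑_z Q² y z φ(z)` (column sums of the reversible
  two-step kernel);
* `entropy_dissipation` : `H(n+2) − H(n) ≥ ∑_y μ_y ∑_z Q² y z (√f_n(z) − √f_{n+2}(y))²`
  (Jensen–Hellinger);
* `sqrt_energy_le_dissipation` : thanks to the laziness `Q² y y ≥ ε₀` of the two-step kernel, the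
  Hellinger Dirichlet form `∑_y ∑_z μ_y Q² y z (√f_n(y) − √f_n(z))²` is bounded by a constant
  times the dissipation.

This is the discrete-time (two-step) version of Nash's 1958 entropy argument; it replaces the
exit-time estimate of Bass–Levin Thm 2.8. [folklore]

## References
* J. Nash, *Continuity of solutions of parabolic and elliptic equations*, Amer. J. Math. 80
  (1958) 931–954, Part II.
* R. F. Bass, D. A. Levin, *Transition probabilities for symmetric jump processes*,
  Trans. Amer. Math. Soc. 354 (2002) 2933–2953, Thm 2.8.
-/

noncomputable section

namespace Literature.Probability.Process

open scoped BigOperators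

variable {d : ℕ} {P : (Fin d → ℤ) → (Fin d → ℤ) → ℝ} {Q : ℕ → (Fin d → ℤ) → (Fin d → ℤ) → ℝ}
  {μ : (Fin d → ℤ) → ℝ} {m M c₁ c₂ α : ℝ}

/-! ### The two-step kernel: column sums and the density recursion -/

/-- Column sums of the reversible two-step kernel: `∑_y μ_y Q² y z = μ_z`. [folklore] -/
theorem hasSum_mu_mul_kpow_two (hP0 : ∀ x y, 0 ≤ P x y) (hP1 : ∀ x, HasSum (P x) 1)
    (hrev : ∀ x y, μ x * P x y = μ y * P y x)
    (hQ0 : ∀ x y, Q 0 x y = if x = y then 1 else 0)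
    (hQ : ∀ n x y, Q (n + 1) x y = ∑' z, Q n x z * P z y) (z : Fin d → ℤ) :
    HasSum (fun y => μ y * Q 2 y z) (μ z) := by
  have hPs : ∀ x, Summable (P x) := fun x => (hP1 x).summable
  have hP1' : ∀ x, ∑' y, P x y ≤ 1 := fun x => ((hP1 x).tsum_eq).le
  have hfun : (fun y => μ y * Q 2 y z) = fun y => μ z * Q 2 z y := by
    funext y; exact kpow_reversible hP0 hPs hP1' hQ0 hQ hrev 2 y z
  rw [hfun]
  have := (kpow_hasSum_one hP0 hP1 hQ0 hQ 2 z).mul_left (μ z)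
  rwa [mul_one] at this

/-- **Density recursion**: `Q (n+2) x y / μ y = ∑_z Q² y z (Q n x z / μ z)`. [folklore] -/
theorem density_two_step (hP0 : ∀ x y, 0 ≤ P x y) (hP1 : ∀ x, HasSum (P x) 1)
    (hμ : ∀ x, m ≤ μ x ∧ μ x ≤ M) (hm : 0 < m)
    (hrev : ∀ x y, μ x * P x y = μ y * P y x)
    (hQ0 : ∀ x y, Q 0 x y = if x = y then 1 else 0)
    (hQ : ∀ n x y, Q (n + 1) x y = ∑' z, Q n x z * P z y) (n : ℕ) (x y : Fin d → ℤ) :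
    Q (n + 2) x y / μ y = ∑' z, Q 2 y z * (Q n x z / μ z) := by
  have hPs : ∀ x, Summable (P x) := fun x => (hP1 x).summable
  have hP1' : ∀ x, ∑' y, P x y ≤ 1 := fun x => ((hP1 x).tsum_eq).le
  have hμpos : ∀ x, 0 < μ x := fun x => lt_of_lt_of_le hm (hμ x).1
  rw [kpow_add hP0 hPs hP1' hQ0 hQ n 2 x y, ← tsum_div_const]
  refine tsum_congr fun z => ?_
  have hr := kpow_reversible hP0 hPs hP1' hQ0 hQ hrev 2 z y
  have h2 : Q 2 z y = μ y * Q 2 y z / μ z := by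
    rw [eq_div_iff (hμpos z).ne']
    calc Q 2 z y * μ z = μ z * Q 2 z y := mul_comm _ _
      _ = μ y * Q 2 y z := hr
  rw [h2, div_eq_iff (hμpos y).ne']
  have hz := (hμpos z).ne'
  field_simp

/-- Elementary facts on the density `f_n = Q n x · / μ`: `0 ≤ f_n ≤ 1/m` and `μ f_n = Q n x ·`.
[folklore] -/
theorem density_bounds (hP0 : ∀ x y, 0 ≤ P x y) (hP1 : ∀ x, HasSum (P x) 1)
    (hμ : ∀ x, m ≤ μ x ∧ μ x ≤ M) (hm : 0 < m)
    (hQ0 : ∀ x y, Q 0 x y = if x = y then 1 else 0)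
    (hQ : ∀ n x y, Q (n + 1) x y = ∑' z, Q n x z * P z y) (n : ℕ) (x z : Fin d → ℤ) :
    0 ≤ Q n x z / μ z ∧ Q n x z / μ z ≤ 1 / m ∧ μ z * (Q n x z / μ z) = Q n x z := by
  have hPs : ∀ x, Summable (P x) := fun x => (hP1 x).summable
  have hP1' : ∀ x, ∑' y, P x y ≤ 1 := fun x => ((hP1 x).tsum_eq).le
  have hμpos : ∀ x, 0 < μ x := fun x => lt_of_lt_of_le hm (hμ x).1
  have hQnn := kpow_nonneg hP0 hQ0 hQ n x z
  refine ⟨div_nonneg hQnn (hμpos z).le, ?_, mul_div_cancel₀ _ (hμpos z).ne'⟩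
  calc Q n x z / μ z ≤ 1 / μ z :=
        div_le_div_of_nonneg_right (kpow_le_one hP0 hPs hP1' hQ0 hQ n x z) (hμpos z).le
    _ ≤ 1 / m := one_div_le_one_div_of_le hm (hμ z).1

/-! ### Absolute summability of the entropy -/

/-- **The entropy series converges absolutely**: for a stable-like kernel with
`P x y ≤ c₂‖x−y‖^{-(d+α)}`, `z ↦ μ_z |f_n(z) log f_n(z)|` is summable (via the finite
`β`-moments and `|u log u| ≤ u(D + |log B|) + e^{-D/2}`). [folklore] -/
theorem entropy_summable (hd : 1 ≤ d) (hP0 : ∀ x y, 0 ≤ P x y) (hP1 : ∀ x, HasSum (P x) 1)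
    (hμ : ∀ x, m ≤ μ x ∧ μ x ≤ M) (hm : 0 < m)
    (hub : ∀ x y, P x y ≤ c₂ * ‖x - y‖ ^ (-((d : ℝ) + α))) (hc₂ : 0 ≤ c₂)
    (hQ0 : ∀ x y, Q 0 x y = if x = y then 1 else 0)
    (hQ : ∀ n x y, Q (n + 1) x y = ∑' z, Q n x z * P z y)
    {β : ℝ} (hβ : 0 < β) (hβ1 : β ≤ 1) (hβα : β < α) (n : ℕ) (x : Fin d → ℤ) :
    Summable fun z => μ z * |Q n x z / μ z * Real.log (Q n x z / μ z)| := by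
  have hμnn : ∀ x, 0 ≤ μ x := fun x => hm.le.trans (hμ x).1
  have hμpos : ∀ x, 0 < μ x := fun x => lt_of_lt_of_le hm (hμ x).1
  have hM : 0 < M := lt_of_lt_of_le hm ((hμ x).1.trans (hμ x).2)
  have hdens := fun z => density_bounds hP0 hP1 hμ hm hQ0 hQ n x z
  obtain ⟨hmom, -⟩ := kpow_moment_summable hd hP0 hP1 hub hc₂ hQ0 hQ hβ hβ1 hβα x n
  obtain ⟨CZ, hCZ, hZ⟩ := tsum_exp_neg_rpow_le hd hβ
  obtain ⟨hexps, -⟩ := hZ (1 / 2) (by norm_num) (by norm_num)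
  have hexps' : Summable fun z : Fin d → ℤ => M * Real.exp (-(1 / 2) * (1 + ‖z - x‖) ^ β) :=
    ((Equiv.subRight x).summable_iff.mpr hexps).mul_left M
  have hPs : ∀ x, Summable (P x) := fun x => (hP1 x).summable
  have hP1' : ∀ x, ∑' y, P x y ≤ 1 := fun x => ((hP1 x).tsum_eq).le
  -- pointwise majorant
  have hpt : ∀ z, μ z * |Q n x z / μ z * Real.log (Q n x z / μ z)| ≤
      (Q n x z * (1 + ‖z - x‖) ^ β + |Real.log (1 / m)| * Q n x z) +
        M * Real.exp (-(1 / 2) * (1 + ‖z - x‖) ^ β) := by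
    intro z
    obtain ⟨hf0, hfB, hμf⟩ := hdens z
    have hD : 1 ≤ (1 + ‖z - x‖) ^ β := Real.one_le_rpow (by linarith [norm_nonneg (z - x)]) hβ.le
    have h := abs_mul_log_le hf0 hfB hD
    have h2 : μ z * |Q n x z / μ z * Real.log (Q n x z / μ z)| ≤
        μ z * (Q n x z / μ z * ((1 + ‖z - x‖) ^ β + |Real.log (1 / m)|) +
          Real.exp (-(1 + ‖z - x‖) ^ β / 2)) := mul_le_mul_of_nonneg_left h (hμnn z)
    have h3 : μ z * (Q n x z / μ z * ((1 + ‖z - x‖) ^ β + |Real.log (1 / m)|) +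
          Real.exp (-(1 + ‖z - x‖) ^ β / 2)) =
        (Q n x z * (1 + ‖z - x‖) ^ β + |Real.log (1 / m)| * Q n x z) +
          μ z * Real.exp (-(1 / 2) * (1 + ‖z - x‖) ^ β) := by
      rw [show -(1 + ‖z - x‖) ^ β / 2 = -(1 / 2) * (1 + ‖z - x‖) ^ β by ring]
      have : μ z * (Q n x z / μ z) = Q n x z := hμf
      calc _ = (μ z * (Q n x z / μ z)) * ((1 + ‖z - x‖) ^ β + |Real.log (1 / m)|) +
            μ z * Real.exp (-(1 / 2) * (1 + ‖z - x‖) ^ β) := by ring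
        _ = _ := by rw [this]; ring
    have h4 : μ z * Real.exp (-(1 / 2) * (1 + ‖z - x‖) ^ β) ≤ M * Real.exp (-(1 / 2) * (1 + ‖z - x‖) ^ β) :=
      mul_le_mul_of_nonneg_right (hμ z).2 (Real.exp_nonneg _)
    linarith
  refine (((hmom.add ((kpow_summable hP0 hPs hP1' hQ0 hQ n x).mul_left _)).add hexps')).of_nonneg_of_le
    (fun z => mul_nonneg (hμnn z) (abs_nonneg _)) hpt

/-! ### Entropy bounds -/

/-- **Entropy lower bound from the on-diagonal estimate**: if `Q n x y ≤ C_D n^{-d/α}` then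
`H(n) = −∑ μ f_n log f_n ≥ (d/α) log n − log (C_D/m)`. [folklore] -/
theorem entropy_lower (hd : 1 ≤ d) (hα : 0 < α) (hP0 : ∀ x y, 0 ≤ P x y) (hP1 : ∀ x, HasSum (P x) 1)
    (hμ : ∀ x, m ≤ μ x ∧ μ x ≤ M) (hm : 0 < m)
    (hub : ∀ x y, P x y ≤ c₂ * ‖x - y‖ ^ (-((d : ℝ) + α))) (hc₂ : 0 ≤ c₂)
    (hQ0 : ∀ x y, Q 0 x y = if x = y then 1 else 0)
    (hQ : ∀ n x y, Q (n + 1) x y = ∑' z, Q n x z * P z y)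
    {C_D : ℝ} (hCD : 0 < C_D)
    (hdiag : ∀ (n : ℕ) (x y : Fin d → ℤ), 1 ≤ n → Q n x y ≤ C_D * (n : ℝ) ^ (-(d : ℝ) / α))
    {n : ℕ} (hn : 1 ≤ n) (x : Fin d → ℤ) :
    (d : ℝ) / α * Real.log n - Real.log (C_D / m) ≤
      -∑' z, μ z * (Q n x z / μ z * Real.log (Q n x z / μ z)) := by
  have hμnn : ∀ x, 0 ≤ μ x := fun x => hm.le.trans (hμ x).1
  have hμpos : ∀ x, 0 < μ x := fun x => lt_of_lt_of_le hm (hμ x).1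
  have hPs : ∀ x, Summable (P x) := fun x => (hP1 x).summable
  have hP1' : ∀ x, ∑' y, P x y ≤ 1 := fun x => ((hP1 x).tsum_eq).le
  have hn0 : (0 : ℝ) < n := by exact_mod_cast hn
  have hα' : (1 : ℝ) ≤ 4 := by norm_num
  -- the bound B_n on the density
  set B : ℝ := C_D * (n : ℝ) ^ (-(d : ℝ) / α) / m with hB
  have hBpos : 0 < B := by rw [hB]; positivity
  have hfB : ∀ z, Q n x z / μ z ≤ B := by
    intro z
    rw [hB]
    calc Q n x z / μ z ≤ C_D * (n : ℝ) ^ (-(d : ℝ) / α) / μ z :=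
          div_le_div_of_nonneg_right (hdiag n x z hn) (hμpos z).le
      _ ≤ C_D * (n : ℝ) ^ (-(d : ℝ) / α) / m :=
          div_le_div_of_nonneg_left (by positivity) hm (hμ z).1
  have hdens := fun z => density_bounds hP0 hP1 hμ hm hQ0 hQ n x z
  -- summability of the entropy series (β = α/2 ∧ 1 works)
  have hent := entropy_summable hd hP0 hP1 hμ hm hub hc₂ hQ0 hQ
    (β := min (α / 2) 1) (lt_min (by linarith) one_pos) (min_le_right _ _)
    (lt_of_le_of_lt (min_le_left _ _) (by linarith)) n x
  have hent' : Summable fun z => μ z * (Q n x z / μ z * Real.log (Q n x z / μ z)) := by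
    refine Summable.of_norm (hent.congr fun z => ?_)
    rw [Real.norm_eq_abs, abs_mul (μ z), abs_of_nonneg (hμnn z)]
  -- pointwise: -μ f log f ≥ -Q log B
  have hpt : ∀ z, -(Real.log B) * Q n x z ≤ -(μ z * (Q n x z / μ z * Real.log (Q n x z / μ z))) := by
    intro z
    obtain ⟨hf0, -, hμf⟩ := hdens z
    have h := neg_mul_log_ge hf0 (hfB z)
    have h2 := mul_le_mul_of_nonneg_left h (hμnn z)
    calc -(Real.log B) * Q n x z = -(Real.log B) * (μ z * (Q n x z / μ z)) := by rw [hμf]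
      _ = μ z * -(Q n x z / μ z * Real.log B) := by ring
      _ ≤ μ z * -(Q n x z / μ z * Real.log (Q n x z / μ z)) := h2
      _ = _ := by ring
  have hlogB : Real.log B = Real.log (C_D / m) - (d : ℝ) / α * Real.log n := by
    rw [hB, show C_D * (n : ℝ) ^ (-(d : ℝ) / α) / m = (C_D / m) * (n : ℝ) ^ (-(d : ℝ) / α) by ring,
      Real.log_mul (by positivity) (Real.rpow_pos_of_pos hn0 _).ne', Real.log_rpow hn0]
    ring
  calc (d : ℝ) / α * Real.log n - Real.log (C_D / m) = -(Real.log B) * 1 := by rw [hlogB]; ring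
    _ = -(Real.log B) * ∑' z, Q n x z := by rw [kpow_tsum_eq_one hP0 hP1 hQ0 hQ n x]
    _ = ∑' z, -(Real.log B) * Q n x z := tsum_mul_left.symm
    _ ≤ ∑' z, -(μ z * (Q n x z / μ z * Real.log (Q n x z / μ z))) :=
        Summable.tsum_le_tsum hpt ((kpow_summable hP0 hPs hP1' hQ0 hQ n x).mul_left _) hent'.neg
    _ = -∑' z, μ z * (Q n x z / μ z * Real.log (Q n x z / μ z)) := tsum_neg

/-- **Entropy upper bound by the `β`-moment** (Gibbs' inequality with the reference density
`∝ e^{-λ(1+‖z−x‖)^β}`, `λ = 1/M_β(n)`): `H(n) ≤ A + (d/β) log M_β(n)` with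
`M_β(n) = ∑_z Q n x z (1+‖z−x‖)^β` and `A` depending only on `d, β, M`. [folklore] -/
theorem entropy_upper (hd : 1 ≤ d) (hP0 : ∀ x y, 0 ≤ P x y) (hP1 : ∀ x, HasSum (P x) 1)
    (hμ : ∀ x, m ≤ μ x ∧ μ x ≤ M) (hm : 0 < m)
    (hub : ∀ x y, P x y ≤ c₂ * ‖x - y‖ ^ (-((d : ℝ) + α))) (hc₂ : 0 ≤ c₂)
    (hQ0 : ∀ x y, Q 0 x y = if x = y then 1 else 0)
    (hQ : ∀ n x y, Q (n + 1) x y = ∑' z, Q n x z * P z y)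
    {β : ℝ} (hβ : 0 < β) (hβ1 : β ≤ 1) (hβα : β < α) :
    ∃ A : ℝ, ∀ (n : ℕ) (x : Fin d → ℤ),
      1 ≤ ∑' z, Q n x z * (1 + ‖z - x‖) ^ β ∧
      -∑' z, μ z * (Q n x z / μ z * Real.log (Q n x z / μ z)) ≤
        A + (d : ℝ) / β * Real.log (∑' z, Q n x z * (1 + ‖z - x‖) ^ β) := by
  have hμnn : ∀ x, 0 ≤ μ x := fun x => hm.le.trans (hμ x).1
  have hμpos : ∀ x, 0 < μ x := fun x => lt_of_lt_of_le hm (hμ x).1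
  have hM : 0 < M := lt_of_lt_of_le hm ((hμ 0).1.trans (hμ 0).2)
  have hPs : ∀ x, Summable (P x) := fun x => (hP1 x).summable
  have hP1' : ∀ x, ∑' y, P x y ≤ 1 := fun x => ((hP1 x).tsum_eq).le
  have hQnn : ∀ k x w, 0 ≤ Q k x w := kpow_nonneg hP0 hQ0 hQ
  obtain ⟨CZ, hCZ, hZ⟩ := tsum_exp_neg_rpow_le hd hβ
  refine ⟨1 + Real.log (M * CZ), fun n x => ?_⟩
  obtain ⟨hmom, -⟩ := kpow_moment_summable hd hP0 hP1 hub hc₂ hQ0 hQ hβ hβ1 hβα x n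
  set Mβ : ℝ := ∑' z, Q n x z * (1 + ‖z - x‖) ^ β with hMβ
  -- M_β ≥ 1
  have hMβ1 : 1 ≤ Mβ := by
    calc (1 : ℝ) = ∑' z, Q n x z := (kpow_tsum_eq_one hP0 hP1 hQ0 hQ n x).symm
      _ ≤ Mβ := Summable.tsum_le_tsum (fun z => le_mul_of_one_le_right (hQnn n x z)
          (Real.one_le_rpow (by linarith [norm_nonneg (z - x)]) hβ.le))
          (kpow_summable hP0 hPs hP1' hQ0 hQ n x) hmom
  have hMβpos : 0 < Mβ := by linarith
  refine ⟨hMβ1, ?_⟩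
  -- λ and the partition function Z
  set lam : ℝ := 1 / Mβ with hlam
  have hlampos : 0 < lam := by rw [hlam]; positivity
  have hlam1 : lam ≤ 1 := by rw [hlam, div_le_one hMβpos]; exact hMβ1
  obtain ⟨hexps, hexple⟩ := hZ lam hlampos hlam1
  set e : (Fin d → ℤ) → ℝ := fun z => Real.exp (-lam * (1 + ‖z - x‖) ^ β) with he
  have hepos : ∀ z, 0 < e z := fun z => Real.exp_pos _
  have hes : Summable fun z => μ z * e z :=
    (((Equiv.subRight x).summable_iff.mpr hexps).mul_left M).of_nonneg_of_le
      (fun z => mul_nonneg (hμnn z) (hepos z).le) (fun z => mul_le_mul_of_nonneg_right (hμ z).2 (hepos z).le)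
  set Z : ℝ := ∑' z, μ z * e z with hZdef
  have hZpos : 0 < Z := by
    have : μ x * e x ≤ Z := hes.le_tsum x (fun z _ => mul_nonneg (hμnn z) (hepos z).le)
    exact lt_of_lt_of_le (mul_pos (hμpos x) (hepos x)) this
  have hZle : Z ≤ M * CZ * lam ^ (-(d : ℝ) / β) := by
    calc Z ≤ ∑' z, M * e z := Summable.tsum_le_tsum (fun z => mul_le_mul_of_nonneg_right (hμ z).2 (hepos z).le)
          hes (((Equiv.subRight x).summable_iff.mpr hexps).mul_left M)
      _ = M * ∑' z, e z := tsum_mul_left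
      _ = M * ∑' h : Fin d → ℤ, Real.exp (-lam * (1 + ‖h‖) ^ β) := by
          congr 1; exact (Equiv.subRight x).tsum_eq (fun h => Real.exp (-lam * (1 + ‖h‖) ^ β))
      _ ≤ M * (CZ * lam ^ (-(d : ℝ) / β)) := mul_le_mul_of_nonneg_left hexple hM.le
      _ = M * CZ * lam ^ (-(d : ℝ) / β) := by ring
  -- the reference density g = e / Z and Gibbs' inequality
  have hdens := fun z => density_bounds hP0 hP1 hμ hm hQ0 hQ n x z
  have hent := entropy_summable hd hP0 hP1 hμ hm hub hc₂ hQ0 hQ hβ hβ1 hβα n x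
  have hent' : Summable fun z => μ z * (Q n x z / μ z * Real.log (Q n x z / μ z)) := by
    refine Summable.of_norm (hent.congr fun z => ?_)
    rw [Real.norm_eq_abs, abs_mul (μ z), abs_of_nonneg (hμnn z)]
  -- pointwise Gibbs: μ (f - g) ≤ μ f log f - μ f log g, with log g = -λ D - log Z
  have hpt : ∀ z, Q n x z - μ z * e z / Z ≤
      μ z * (Q n x z / μ z * Real.log (Q n x z / μ z)) +
        (lam * (Q n x z * (1 + ‖z - x‖) ^ β) + Real.log Z * Q n x z) := by
    intro z
    obtain ⟨hf0, -, hμf⟩ := hdens z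
    have hgpos : 0 < e z / Z := div_pos (hepos z) hZpos
    have h := sub_le_mul_log_div hf0 hgpos
    have hlogg : Real.log (e z / Z) = -lam * (1 + ‖z - x‖) ^ β - Real.log Z := by
      rw [Real.log_div (hepos z).ne' hZpos.ne', he, Real.log_exp]
    have hsplit : Q n x z / μ z * Real.log (Q n x z / μ z / (e z / Z)) =
        Q n x z / μ z * Real.log (Q n x z / μ z) - Q n x z / μ z * Real.log (e z / Z) := by
      rcases hf0.eq_or_lt with h0 | hfpos
      · rw [← h0]; simp
      · rw [Real.log_div hfpos.ne' hgpos.ne']; ring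
    rw [hsplit, hlogg] at h
    have h2 := mul_le_mul_of_nonneg_left h (hμnn z)
    have h3 : μ z * (Q n x z / μ z - e z / Z) = Q n x z - μ z * e z / Z := by
      rw [mul_sub, hμf]; ring
    have h4 : μ z * (Q n x z / μ z * Real.log (Q n x z / μ z) -
          Q n x z / μ z * (-lam * (1 + ‖z - x‖) ^ β - Real.log Z)) =
        μ z * (Q n x z / μ z * Real.log (Q n x z / μ z)) +
          (lam * (Q n x z * (1 + ‖z - x‖) ^ β) + Real.log Z * Q n x z) := by
      have : μ z * (Q n x z / μ z) = Q n x z := hμf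
      calc _ = μ z * (Q n x z / μ z * Real.log (Q n x z / μ z)) +
            (μ z * (Q n x z / μ z)) * (lam * (1 + ‖z - x‖) ^ β + Real.log Z) := by ring
        _ = _ := by rw [this]; ring
    linarith
  have hrhs_s : Summable fun z => μ z * (Q n x z / μ z * Real.log (Q n x z / μ z)) +
      (lam * (Q n x z * (1 + ‖z - x‖) ^ β) + Real.log Z * Q n x z) :=
    hent'.add ((hmom.mul_left lam).add ((kpow_summable hP0 hPs hP1' hQ0 hQ n x).mul_left _))
  have hlhs_s : Summable fun z => Q n x z - μ z * e z / Z :=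
    (kpow_summable hP0 hPs hP1' hQ0 hQ n x).sub (hes.div_const Z)
  have hsum := Summable.tsum_le_tsum hpt hlhs_s hrhs_s
  rw [Summable.tsum_sub (kpow_summable hP0 hPs hP1' hQ0 hQ n x) (hes.div_const Z), tsum_div_const,
    kpow_tsum_eq_one hP0 hP1 hQ0 hQ n x, ← hZdef, div_self hZpos.ne', sub_self,
    Summable.tsum_add hent' ((hmom.mul_left lam).add ((kpow_summable hP0 hPs hP1' hQ0 hQ n x).mul_left _)),
    Summable.tsum_add (hmom.mul_left lam) ((kpow_summable hP0 hPs hP1' hQ0 hQ n x).mul_left _),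
    tsum_mul_left, tsum_mul_left, kpow_tsum_eq_one hP0 hP1 hQ0 hQ n x, mul_one, ← hMβ] at hsum
  -- λ M_β = 1 and log Z ≤ log (M CZ) + (d/β) log M_β
  have hlamM : lam * Mβ = 1 := by rw [hlam]; field_simp
  have hlogZ : Real.log Z ≤ Real.log (M * CZ) + (d : ℝ) / β * Real.log Mβ := by
    have h1 := Real.log_le_log hZpos hZle
    rw [Real.log_mul (by positivity) (Real.rpow_pos_of_pos hlampos _).ne', Real.log_rpow hlampos, hlam,
      one_div, Real.log_inv] at h1
    calc Real.log Z ≤ Real.log (M * CZ) + -(d : ℝ) / β * -Real.log Mβ := h1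
      _ = Real.log (M * CZ) + (d : ℝ) / β * Real.log Mβ := by ring
  linarith

/-! ### Fubini through the two-step kernel and the entropy dissipation -/

/-- **Disintegration along the two-step kernel**: if `z ↦ μ_z |φ z|` is summable then
`∑_z μ_z φ(z) = ∑_y μ_y ∑_z Q² y z φ(z)`, with all inner and outer series summable. [folklore] -/
theorem entropy_fubini (hP0 : ∀ x y, 0 ≤ P x y) (hP1 : ∀ x, HasSum (P x) 1)
    (hμ : ∀ x, m ≤ μ x ∧ μ x ≤ M) (hm : 0 < m)
    (hrev : ∀ x y, μ x * P x y = μ y * P y x)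
    (hQ0 : ∀ x y, Q 0 x y = if x = y then 1 else 0)
    (hQ : ∀ n x y, Q (n + 1) x y = ∑' z, Q n x z * P z y)
    {φ : (Fin d → ℤ) → ℝ} (hφ : Summable fun z => μ z * |φ z|) :
    (∀ y, Summable fun z => Q 2 y z * φ z) ∧
    (Summable fun y => μ y * ∑' z, Q 2 y z * φ z) ∧
    ∑' z, μ z * φ z = ∑' y, μ y * ∑' z, Q 2 y z * φ z := by
  have hPs : ∀ x, Summable (P x) := fun x => (hP1 x).summable
  have hP1' : ∀ x, ∑' y, P x y ≤ 1 := fun x => ((hP1 x).tsum_eq).le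
  have hμnn : ∀ x, 0 ≤ μ x := fun x => hm.le.trans (hμ x).1
  have hμpos : ∀ x, 0 < μ x := fun x => lt_of_lt_of_le hm (hμ x).1
  have hQnn : ∀ k x w, 0 ≤ Q k x w := kpow_nonneg hP0 hQ0 hQ
  have hcol := hasSum_mu_mul_kpow_two hP0 hP1 hrev hQ0 hQ
  -- the transposed nonnegative family |F| (z, y) ↦ μ y * Q 2 y z * |φ z| is summable
  have habs1 : ∀ z, Summable fun y => μ y * Q 2 y z * |φ z| := fun z => (hcol z).summable.mul_right _
  have habs1_sum : ∀ z, ∑' y, μ y * Q 2 y z * |φ z| = μ z * |φ z| := fun z => by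
    rw [tsum_mul_right, (hcol z).tsum_eq]
  have habs2 : Summable fun z => ∑' y, μ y * Q 2 y z * |φ z| := by
    exact hφ.congr (fun z => (habs1_sum z).symm)
  have hT : Summable (Function.uncurry fun z y => μ y * Q 2 y z * |φ z|) :=
    summable_uncurry_of_nonneg (fun z y => mul_nonneg (mul_nonneg (hμnn y) (hQnn 2 y z)) (abs_nonneg _))
      habs1 habs2
  -- hence the signed family F (y, z) ↦ μ y * Q 2 y z * φ z is summable
  have hF : Summable (Function.uncurry fun y z => μ y * Q 2 y z * φ z) := by
    have hT' : Summable fun p : (Fin d → ℤ) × (Fin d → ℤ) => μ p.1 * Q 2 p.1 p.2 * |φ p.2| :=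
      hT.prod_symm
    refine Summable.of_norm (hT'.congr fun p => ?_)
    simp only [Function.uncurry, Real.norm_eq_abs, abs_mul, abs_of_nonneg (hμnn _), abs_of_nonneg (hQnn _ _ _)]
  have hrow : ∀ y, Summable fun z => μ y * Q 2 y z * φ z := fun y => hF.prod_factor y
  have hinner : ∀ y, Summable fun z => Q 2 y z * φ z := by
    intro y
    have := (hrow y).mul_left (μ y)⁻¹
    refine this.congr fun z => ?_
    change (μ y)⁻¹ * (μ y * Q 2 y z * φ z) = Q 2 y z * φ z
    rw [mul_assoc (μ y), ← mul_assoc, inv_mul_cancel₀ (hμpos y).ne', one_mul]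
  refine ⟨hinner, ?_, ?_⟩
  · have h := hF.prod
    refine h.congr fun y => ?_
    change ∑' z, μ y * Q 2 y z * φ z = μ y * ∑' z, Q 2 y z * φ z
    rw [← tsum_mul_left]; exact tsum_congr fun z => by ring
  · calc ∑' z, μ z * φ z = ∑' z, ∑' y, μ y * Q 2 y z * φ z := by
          refine tsum_congr fun z => ?_
          rw [tsum_mul_right, (hcol z).tsum_eq]
      _ = ∑' y, ∑' z, μ y * Q 2 y z * φ z := hF.tsum_comm
      _ = ∑' y, μ y * ∑' z, Q 2 y z * φ z := by
          refine tsum_congr fun y => ?_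
          rw [← tsum_mul_left]; exact tsum_congr fun z => by ring

/-- **Entropy dissipation over two steps (Jensen–Hellinger).** With `f_n = Q n x · / μ`,
`H(n+2) − H(n) ≥ ∑_y μ_y ∑_z Q² y z (√f_n(z) − √f_{n+2}(y))²`, and the right-hand side is a
summable series of nonnegative terms. [folklore] -/
theorem entropy_dissipation (hd : 1 ≤ d) (hP0 : ∀ x y, 0 ≤ P x y) (hP1 : ∀ x, HasSum (P x) 1)
    (hμ : ∀ x, m ≤ μ x ∧ μ x ≤ M) (hm : 0 < m)
    (hrev : ∀ x y, μ x * P x y = μ y * P y x)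
    (hub : ∀ x y, P x y ≤ c₂ * ‖x - y‖ ^ (-((d : ℝ) + α))) (hc₂ : 0 ≤ c₂) (hα : 0 < α)
    (hQ0 : ∀ x y, Q 0 x y = if x = y then 1 else 0)
    (hQ : ∀ n x y, Q (n + 1) x y = ∑' z, Q n x z * P z y) (n : ℕ) (x : Fin d → ℤ) :
    (∀ y, Summable fun z => Q 2 y z * (Real.sqrt (Q n x z / μ z) - Real.sqrt (Q (n + 2) x y / μ y)) ^ 2) ∧
    (Summable fun y => μ y * ∑' z, Q 2 y z *
        (Real.sqrt (Q n x z / μ z) - Real.sqrt (Q (n + 2) x y / μ y)) ^ 2) ∧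
    ∑' y, μ y * ∑' z, Q 2 y z * (Real.sqrt (Q n x z / μ z) - Real.sqrt (Q (n + 2) x y / μ y)) ^ 2 ≤
      (-∑' y, μ y * (Q (n + 2) x y / μ y * Real.log (Q (n + 2) x y / μ y))) -
      (-∑' z, μ z * (Q n x z / μ z * Real.log (Q n x z / μ z))) := by
  have hPs : ∀ x, Summable (P x) := fun x => (hP1 x).summable
  have hP1' : ∀ x, ∑' y, P x y ≤ 1 := fun x => ((hP1 x).tsum_eq).le
  have hμnn : ∀ x, 0 ≤ μ x := fun x => hm.le.trans (hμ x).1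
  have hμpos : ∀ x, 0 < μ x := fun x => lt_of_lt_of_le hm (hμ x).1
  have hQnn : ∀ k x w, 0 ≤ Q k x w := kpow_nonneg hP0 hQ0 hQ
  have hdens := fun z => density_bounds hP0 hP1 hμ hm hQ0 hQ n x z
  have hdens2 := fun y => density_bounds hP0 hP1 hμ hm hQ0 hQ (n + 2) x y
  have htwo := fun y => density_two_step hP0 hP1 hμ hm hrev hQ0 hQ n x y
  -- Jensen–Hellinger for each y with weights Q 2 y ·
  have hJ := fun y => jensen_hellinger (w := Q 2 y) (a := fun z => Q n x z / μ z) (B := 1 / m)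
    (hQnn 2 y) (kpow_hasSum_one hP0 hP1 hQ0 hQ 2 y) (fun z => (hdens z).1) (fun z => (hdens z).2.1)
  -- entropy summability at times n and n+2 (β = min (α/2) 1)
  have hβ : 0 < min (α / 2) 1 := lt_min (by linarith) one_pos
  have hβ1 : min (α / 2) 1 ≤ 1 := min_le_right _ _
  have hβα : min (α / 2) 1 < α := lt_of_le_of_lt (min_le_left _ _) (by linarith)
  have hent := entropy_summable hd hP0 hP1 hμ hm hub hc₂ hQ0 hQ hβ hβ1 hβα n x
  have hent2 := entropy_summable hd hP0 hP1 hμ hm hub hc₂ hQ0 hQ hβ hβ1 hβα (n + 2) x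
  have hent2' : Summable fun y => μ y * (Q (n + 2) x y / μ y * Real.log (Q (n + 2) x y / μ y)) := by
    refine Summable.of_norm (hent2.congr fun z => ?_)
    rw [Real.norm_eq_abs, abs_mul (μ z), abs_of_nonneg (hμnn z)]
  -- Fubini for φ = f log f
  obtain ⟨-, hFs, hFeq⟩ := entropy_fubini hP0 hP1 hμ hm hrev hQ0 hQ hent
  -- inner summability and pointwise inequality
  have hinner : ∀ y, Summable fun z => Q 2 y z *
      (Real.sqrt (Q n x z / μ z) - Real.sqrt (Q (n + 2) x y / μ y)) ^ 2 := by
    intro y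
    have := (hJ y).2.2.1
    rwa [← htwo y] at this
  have hpt : ∀ y, μ y * ∑' z, Q 2 y z * (Real.sqrt (Q n x z / μ z) - Real.sqrt (Q (n + 2) x y / μ y)) ^ 2 ≤
      -(μ y * (Q (n + 2) x y / μ y * Real.log (Q (n + 2) x y / μ y))) +
        μ y * ∑' z, Q 2 y z * (Q n x z / μ z * Real.log (Q n x z / μ z)) := by
    intro y
    have h := (hJ y).2.2.2
    rw [← htwo y] at h
    have := mul_le_mul_of_nonneg_left h (hμnn y)
    linarith
  -- outer summability: μ_y h_y ≤ 2 Q (n+2) x y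
  have hbound : ∀ y, μ y * ∑' z, Q 2 y z * (Real.sqrt (Q n x z / μ z) - Real.sqrt (Q (n + 2) x y / μ y)) ^ 2 ≤
      2 * Q (n + 2) x y := by
    intro y
    obtain ⟨ha0, -, hμa⟩ := hdens2 y
    have hsq : ∀ z, Q 2 y z * (Real.sqrt (Q n x z / μ z) - Real.sqrt (Q (n + 2) x y / μ y)) ^ 2 ≤
        Q 2 y z * (Q n x z / μ z) + Q 2 y z * (Q (n + 2) x y / μ y) := by
      intro z
      have h1 : (Real.sqrt (Q n x z / μ z) - Real.sqrt (Q (n + 2) x y / μ y)) ^ 2 ≤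
          Q n x z / μ z + Q (n + 2) x y / μ y := by
        rw [sub_sq, Real.sq_sqrt (hdens z).1, Real.sq_sqrt ha0]
        nlinarith [Real.sqrt_nonneg (Q n x z / μ z), Real.sqrt_nonneg (Q (n + 2) x y / μ y)]
      calc _ ≤ Q 2 y z * (Q n x z / μ z + Q (n + 2) x y / μ y) := mul_le_mul_of_nonneg_left h1 (hQnn 2 y z)
        _ = _ := by ring
    have hws := (hJ y).1
    have hQ2s := kpow_summable hP0 hPs hP1' hQ0 hQ 2 y
    calc μ y * ∑' z, Q 2 y z * (Real.sqrt (Q n x z / μ z) - Real.sqrt (Q (n + 2) x y / μ y)) ^ 2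
        ≤ μ y * ∑' z, (Q 2 y z * (Q n x z / μ z) + Q 2 y z * (Q (n + 2) x y / μ y)) :=
          mul_le_mul_of_nonneg_left (Summable.tsum_le_tsum hsq (hinner y) (hws.add (hQ2s.mul_right _))) (hμnn y)
      _ = μ y * (Q (n + 2) x y / μ y + Q (n + 2) x y / μ y) := by
          rw [Summable.tsum_add hws (hQ2s.mul_right _), tsum_mul_right, kpow_tsum_eq_one hP0 hP1 hQ0 hQ 2 y,
            one_mul, ← htwo y]
      _ = 2 * Q (n + 2) x y := by rw [← two_mul, ← mul_assoc, mul_comm (μ y) 2, mul_assoc, hμa]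
  have hout : Summable fun y => μ y * ∑' z, Q 2 y z *
      (Real.sqrt (Q n x z / μ z) - Real.sqrt (Q (n + 2) x y / μ y)) ^ 2 :=
    ((kpow_summable hP0 hPs hP1' hQ0 hQ (n + 2) x).mul_left 2).of_nonneg_of_le
      (fun y => mul_nonneg (hμnn y) (tsum_nonneg fun z => mul_nonneg (hQnn 2 y z) (sq_nonneg _))) hbound
  refine ⟨hinner, hout, ?_⟩
  calc ∑' y, μ y * ∑' z, Q 2 y z * (Real.sqrt (Q n x z / μ z) - Real.sqrt (Q (n + 2) x y / μ y)) ^ 2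
      ≤ ∑' y, (-(μ y * (Q (n + 2) x y / μ y * Real.log (Q (n + 2) x y / μ y))) +
          μ y * ∑' z, Q 2 y z * (Q n x z / μ z * Real.log (Q n x z / μ z))) :=
        Summable.tsum_le_tsum hpt hout (hent2'.neg.add hFs)
    _ = (-∑' y, μ y * (Q (n + 2) x y / μ y * Real.log (Q (n + 2) x y / μ y))) +
          ∑' y, μ y * ∑' z, Q 2 y z * (Q n x z / μ z * Real.log (Q n x z / μ z)) := by
        rw [Summable.tsum_add hent2'.neg hFs, tsum_neg]
    _ = _ := by rw [← hFeq]; ring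

/-- **Laziness turns the dissipation into a Hellinger Dirichlet form.** If `Q² y y ≥ ε₀ > 0`,
then `∑_y μ_y ∑_z Q² y z (√f_n(y) − √f_n(z))² ≤ (2/ε₀ + 2) ∑_y μ_y h(y)` where
`h(y) = ∑_z Q² y z (√f_n(z) − √f_{n+2}(y))²` is the dissipation density; the left-hand
series are summable. [folklore] -/
theorem sqrt_energy_le_dissipation (hd : 1 ≤ d) (hP0 : ∀ x y, 0 ≤ P x y) (hP1 : ∀ x, HasSum (P x) 1)
    (hμ : ∀ x, m ≤ μ x ∧ μ x ≤ M) (hm : 0 < m)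
    (hrev : ∀ x y, μ x * P x y = μ y * P y x)
    (hub : ∀ x y, P x y ≤ c₂ * ‖x - y‖ ^ (-((d : ℝ) + α))) (hc₂ : 0 ≤ c₂) (hα : 0 < α)
    (hQ0 : ∀ x y, Q 0 x y = if x = y then 1 else 0)
    (hQ : ∀ n x y, Q (n + 1) x y = ∑' z, Q n x z * P z y)
    {ε₀ : ℝ} (hε₀ : 0 < ε₀) (hlazy : ∀ y, ε₀ ≤ Q 2 y y) (n : ℕ) (x : Fin d → ℤ) :
    (∀ y, Summable fun z => Q 2 y z * (Real.sqrt (Q n x y / μ y) - Real.sqrt (Q n x z / μ z)) ^ 2) ∧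
    (Summable fun y => μ y * ∑' z, Q 2 y z * (Real.sqrt (Q n x y / μ y) - Real.sqrt (Q n x z / μ z)) ^ 2) ∧
    ∑' y, μ y * ∑' z, Q 2 y z * (Real.sqrt (Q n x y / μ y) - Real.sqrt (Q n x z / μ z)) ^ 2 ≤
      (2 / ε₀ + 2) * ∑' y, μ y * ∑' z, Q 2 y z *
        (Real.sqrt (Q n x z / μ z) - Real.sqrt (Q (n + 2) x y / μ y)) ^ 2 := by
  have hPs : ∀ x, Summable (P x) := fun x => (hP1 x).summable
  have hP1' : ∀ x, ∑' y, P x y ≤ 1 := fun x => ((hP1 x).tsum_eq).le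
  have hμnn : ∀ x, 0 ≤ μ x := fun x => hm.le.trans (hμ x).1
  have hQnn : ∀ k x w, 0 ≤ Q k x w := kpow_nonneg hP0 hQ0 hQ
  have hdens := fun z => density_bounds hP0 hP1 hμ hm hQ0 hQ n x z
  have hdens2 := fun y => density_bounds hP0 hP1 hμ hm hQ0 hQ (n + 2) x y
  obtain ⟨hinner, hout, -⟩ := entropy_dissipation hd hP0 hP1 hμ hm hrev hub hc₂ hα hQ0 hQ n x
  -- abbreviations for the square roots
  set sf : (Fin d → ℤ) → ℝ := fun z => Real.sqrt (Q n x z / μ z) with hsf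
  set sa : (Fin d → ℤ) → ℝ := fun y => Real.sqrt (Q (n + 2) x y / μ y) with hsa
  -- pointwise in z
  have hptz : ∀ y z, Q 2 y z * (sf y - sf z) ^ 2 ≤
      2 * (sf y - sa y) ^ 2 * Q 2 y z + 2 * (Q 2 y z * (sf z - sa y) ^ 2) := by
    intro y z
    have : (sf y - sf z) ^ 2 ≤ 2 * (sf y - sa y) ^ 2 + 2 * (sf z - sa y) ^ 2 := by
      nlinarith [sq_nonneg (sf y + sf z - 2 * sa y)]
    calc Q 2 y z * (sf y - sf z) ^ 2 ≤ Q 2 y z * (2 * (sf y - sa y) ^ 2 + 2 * (sf z - sa y) ^ 2) :=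
          mul_le_mul_of_nonneg_left this (hQnn 2 y z)
      _ = _ := by ring
  have hQ2s : ∀ y, Summable (Q 2 y) := fun y => kpow_summable hP0 hPs hP1' hQ0 hQ 2 y
  have hinner' : ∀ y, Summable fun z => Q 2 y z * (sf y - sf z) ^ 2 := by
    intro y
    refine (((hQ2s y).mul_left (2 * (sf y - sa y) ^ 2)).add ((hinner y).mul_left 2)).of_nonneg_of_le
      (fun z => mul_nonneg (hQnn 2 y z) (sq_nonneg _)) (fun z => ?_)
    have := hptz y z
    simpa only [hsf, hsa] using this
  -- the diagonal term controls (sf y - sa y)²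
  have hdiag : ∀ y, (sf y - sa y) ^ 2 ≤ ε₀⁻¹ * ∑' z, Q 2 y z * (sf z - sa y) ^ 2 := by
    intro y
    have h1 : Q 2 y y * (sf y - sa y) ^ 2 ≤ ∑' z, Q 2 y z * (sf z - sa y) ^ 2 :=
      (hinner y).le_tsum y (fun z _ => mul_nonneg (hQnn 2 y z) (sq_nonneg _))
    have h2 : ε₀ * (sf y - sa y) ^ 2 ≤ Q 2 y y * (sf y - sa y) ^ 2 :=
      mul_le_mul_of_nonneg_right (hlazy y) (sq_nonneg _)
    rw [← div_eq_inv_mul, le_div_iff₀ hε₀, mul_comm]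
    linarith
  have hpty : ∀ y, μ y * ∑' z, Q 2 y z * (sf y - sf z) ^ 2 ≤
      (2 / ε₀ + 2) * (μ y * ∑' z, Q 2 y z * (sf z - sa y) ^ 2) := by
    intro y
    have hsum : ∑' z, Q 2 y z * (sf y - sf z) ^ 2 ≤
        2 * (sf y - sa y) ^ 2 * 1 + 2 * ∑' z, Q 2 y z * (sf z - sa y) ^ 2 := by
      calc ∑' z, Q 2 y z * (sf y - sf z) ^ 2
          ≤ ∑' z, (2 * (sf y - sa y) ^ 2 * Q 2 y z + 2 * (Q 2 y z * (sf z - sa y) ^ 2)) :=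
            Summable.tsum_le_tsum (hptz y) (hinner' y)
              (((hQ2s y).mul_left _).add ((hinner y).mul_left 2))
        _ = 2 * (sf y - sa y) ^ 2 * ∑' z, Q 2 y z + 2 * ∑' z, Q 2 y z * (sf z - sa y) ^ 2 := by
            rw [Summable.tsum_add ((hQ2s y).mul_left _) ((hinner y).mul_left 2), tsum_mul_left, tsum_mul_left]
        _ = _ := by rw [kpow_tsum_eq_one hP0 hP1 hQ0 hQ 2 y]
    have hT : 0 ≤ ∑' z, Q 2 y z * (sf z - sa y) ^ 2 :=
      tsum_nonneg fun z => mul_nonneg (hQnn 2 y z) (sq_nonneg _)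
    have h3 := hdiag y
    have h4 : ∑' z, Q 2 y z * (sf y - sf z) ^ 2 ≤ (2 / ε₀ + 2) * ∑' z, Q 2 y z * (sf z - sa y) ^ 2 := by
      rw [div_eq_mul_inv, add_mul, mul_assoc]
      nlinarith
    calc μ y * ∑' z, Q 2 y z * (sf y - sf z) ^ 2 ≤ μ y * ((2 / ε₀ + 2) * ∑' z, Q 2 y z * (sf z - sa y) ^ 2) :=
          mul_le_mul_of_nonneg_left h4 (hμnn y)
      _ = _ := by ring
  have hout' : Summable fun y => μ y * ∑' z, Q 2 y z * (sf y - sf z) ^ 2 :=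
    (hout.mul_left (2 / ε₀ + 2)).of_nonneg_of_le
      (fun y => mul_nonneg (hμnn y) (tsum_nonneg fun z => mul_nonneg (hQnn 2 y z) (sq_nonneg _)))
      (fun y => by have := hpty y; simpa only [hsf, hsa] using this)
  refine ⟨hinner', hout', ?_⟩
  calc ∑' y, μ y * ∑' z, Q 2 y z * (sf y - sf z) ^ 2
      ≤ ∑' y, (2 / ε₀ + 2) * (μ y * ∑' z, Q 2 y z * (sf z - sa y) ^ 2) :=
        Summable.tsum_le_tsum hpty hout' (hout.mul_left _)
    _ = (2 / ε₀ + 2) * ∑' y, μ y * ∑' z, Q 2 y z * (sf z - sa y) ^ 2 := tsum_mul_left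

end Literature.Probability.Process
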